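import Literature.Topology.FourManifolds.BoundaryGluingConstruction
import Literature.Topology.FourManifolds.OpenCollarExistence
import Literature.Topology.FourManifolds.GluingSmoothing
import HarnessLib

/-!
# Existence and uniqueness of the gluing `M ∪_φ N` (discharges of `exists_isBoundaryGluing` and `nonempty_diffeomorph_of_isBoundaryGluing`)

Topic `Literature/Topology/FourManifolds` (fact seat
`provefact-Literature.Topology.FourManifolds.exists_isBoundaryGluing`), sibling of `Gluing.lean`.
Everything here is proved.

* `Literature.Topology.FourManifolds.exists_isBoundaryGluing_holds` — **discharge of the named fact
  `Literature.Topology.FourManifolds.exists_isBoundaryGluing`** of `Gluing.lean`: for compact Hausdorff smooth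
  `(n+1)`-manifolds with boundary `M`, `N` (any `n`, so dimension `≥ 1`), boundary data `bM`, `bN`
  and every diffeomorphism `φ : ∂M ≅ ∂N`, there is a compact Hausdorff second-countable smooth
  `(n+1)`-manifold without boundary which is the gluing of `M` and `N` along `φ`
  (Bröcker–Jänich, *Introduction to Differential Topology* (1982), (13.8), (13.11); Hirsch,
  *Differential Topology* (1976), Ch. 8 §2; Milnor, *Lectures on the h-cobordism theorem* (1965),
  Thm. 1.4).  Proof: long open collars of both boundaries exist (`OpenCollarExistence.lean`, the
  tree's flow-out collar in every dimension), and the three open pieces `M - ∂M`, `∂M × ℝ`,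
  `N - ∂N` are glued along them (`BoundaryGluingConstruction.lean`); an empty boundary is treated
  apart (`isBoundaryGluing_interiorSum`, same file: the gluing is then the disjoint union, realised
  as the interior of `M ⊕ N`).

## On the hypotheses of the named fact

The `def exists_isBoundaryGluing` of `Gluing.lean` is stated inside a section whose variables make
`M`, `N` compact Hausdorff second-countable `C^∞` manifolds, but, being a `def` whose body does
not use those instance hypotheses, its elaborated parameters are only the charted-space structures
of `M`, `N` and the boundary data (`#check @exists_isBoundaryGluing`).  The docstring of the fact,
its sources and its dependents (e.g. `TwistedSpheres.lean`, two closed balls) all concern compact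
Hausdorff smooth manifolds, and at degenerate indices the bare family is false (a non-Hausdorff
`M` does not embed in a Hausdorff `P`).  Accordingly the discharge below carries the hypotheses
`[T2Space M] [CompactSpace M] [IsManifold (𝓡∂ (n + 1)) ∞ M]` (and for `N`), exactly as the tree's
other parametrised discharges do (e.g. `Cobordism.exists_isMorseFunction_holds`); second
countability of `M`, `N` is not needed.

## Uniqueness of the gluing (discharge of `nonempty_diffeomorph_of_isBoundaryGluing`)

* `Literature.Topology.FourManifolds.nonempty_diffeomorph_of_isBoundaryGluing_holds` — **discharge
  of the named fact `Literature.Topology.FourManifolds.nonempty_diffeomorph_of_isBoundaryGluing`**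
  of `Gluing.lean` (Hirsch, *Differential Topology* (1976), Ch. 8, Thm. 2.1 with Thm. 1.9;
  Bröcker–Jänich (1982), (13.9) with the uniqueness of collars (13.7)): two smooth manifolds
  `P`, `P'` which are both the gluing of the compact Hausdorff pieces `M`, `N` along the same
  diffeomorphism `φ : ∂M ≅ ∂N` are diffeomorphic.  The proof is the eight-file development
  `BoundaryGluingData.lean` (the witnesses and the comparison homeomorphism `jA a ↦ jA' a`,
  `jB b ↦ jB' b`, smooth off the seam), `SeamFunction.lean`, `SeamTube.lean` (product
  neighbourhoods of the seam by flows), `CollarGerm.lean`, `CollarGermExtension.lean` (uniqueness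
  of collars in germ form, flow-free), `GluingGerms.lean`, `GluingSmoothing.lean` (Hirsch's
  `f' ∪ f''`: the comparison map corrected near the seam), assembled as
  `BoundaryGluingData.nonempty_diffeomorph`.
* `nonempty_diffeomorph_of_isBoundaryGluing_closedBall_of_isManifold` — the same for two closed
  discs without separation hypotheses on `P`, `P'` (the shape of the hypothesis `hU` of
  `cerf_twistedSphere_four_of_pi0Diff`, `RadialExtension.lean`).
* `nonempty_diffeomorph_of_isBoundaryGluing_compact` (+ `_holds`) — the closed, unparametrised
  form of the statement with its hypotheses explicit.

Exactly as for `exists_isBoundaryGluing` above, the `def nonempty_diffeomorph_of_isBoundaryGluing`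
is stated in a section of `Gluing.lean` making `M`, `N` compact Hausdorff second-countable `C^∞`
manifolds and `P`, `P'` `C^∞` manifolds, but its elaborated parameters are only the charted-space
structures (`#check @nonempty_diffeomorph_of_isBoundaryGluing`); the bare family over-states the
printed theorem (Hirsch's manifolds are Hausdorff paracompact, Bröcker–Jänich assume a compact
boundary) and is not what is proved.  Accordingly the discharge carries
`[T2Space M] [CompactSpace M] [IsManifold (𝓡∂ (n + 1)) ∞ M]` (and for `N`) and
`[IsManifold (𝓡 (n + 1)) ∞ P]`, `[IsManifold (𝓡 (n + 1)) ∞ P']`; second countability is not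
needed, and no separation hypothesis on `P`, `P'` is needed (a gluing of compact Hausdorff
pieces is Hausdorff, `BoundaryGluingData.t2Space`).  This covers every use in the tree (all with
`M = N = 𝔻ⁿ⁺¹`).

## References

* T. Bröcker, K. Jänich, *Introduction to Differential Topology*, CUP (1982), §13: (13.6),
  (13.8), (13.11). [BrockerJanich1982]
* M. W. Hirsch, *Differential Topology*, GTM 33 (1976), Ch. 8 §2 (Thm. 2.1), §1 (Thm. 1.9)
  (held copy, PDF pp. 168–171). [Hirsch1976] [HirschDT1976]
* J. Milnor, *Lectures on the h-cobordism theorem*, Princeton (1965), §1, Thm. 1.4.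
  [MilnorHCobordism1965]
-/

open scoped Manifold ContDiff Topology
open Set Function Topology

noncomputable section

namespace Literature.Topology.FourManifolds

universe u

/-! ### Discharge of `exists_isBoundaryGluing` -/

section Discharge

variable {n : ℕ} {M N : Type u} [TopologicalSpace M] [T2Space M]
  [ChartedSpace (EuclideanHalfSpace (n + 1)) M] [IsManifold (𝓡∂ (n + 1)) ∞ M] [CompactSpace M]
  [TopologicalSpace N] [T2Space N] [ChartedSpace (EuclideanHalfSpace (n + 1)) N] [IsManifold (𝓡∂ (n + 1)) ∞ N]
  [CompactSpace N] {bM : BoundaryData (𝓡∂ (n + 1)) M (𝓡 n)} {bN : BoundaryData (𝓡∂ (n + 1)) N (𝓡 n)}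

variable (bM bN) in
/-- **Existence of the gluing `M ∪_φ N` — discharge of the named fact
`Literature.Topology.FourManifolds.exists_isBoundaryGluing`.**  For compact Hausdorff smooth `(n+1)`-manifolds with
boundary `M`, `N`, boundary data `bM`, `bN` and a diffeomorphism `φ : ∂M ≅ ∂N` there is a
compact Hausdorff second-countable smooth `(n+1)`-manifold without boundary `P` which is the
gluing of `M` and `N` along `φ`: with long open collars of both boundaries
(`BoundaryData.nonempty_openCollar`, Bröcker–Jänich (13.6)) glue the open pieces `∂M × ℝ`,
`M - ∂M`, `N - ∂N` (`BoundaryGlueData.isBoundaryGluing`, Bröcker–Jänich (13.8), (13.11) =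
Milnor's proof of Thm. 1.4); an empty boundary gives the disjoint union
(`isBoundaryGluing_interiorSum`).  The hypotheses on `M`, `N` are those of the section of
`Gluing.lean` in which the fact is stated (see the module docstring).
[cite: BrockerJanich1982, (13.11)] -/
theorem exists_isBoundaryGluing_holds : exists_isBoundaryGluing bM bN := by
  intro φ
  rcases isEmpty_or_nonempty bM.carrier with hE | hNE
  · haveI : IsEmpty bN.carrier := φ.toEquiv.symm.isEmpty
    haveI := compactSpace_interiorSum bM.isInteriorPoint_of_isEmpty bN.isInteriorPoint_of_isEmpty
    haveI : SecondCountableTopology (InteriorManifold (𝓡∂ (n + 1)) (M ⊕ N)) :=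
      ChartedSpace.secondCountable_of_sigmaCompact (EuclideanSpace ℝ (Fin (n + 1))) _
    exact ⟨InteriorManifold (𝓡∂ (n + 1)) (M ⊕ N), inferInstance, inferInstance, inferInstance,
      inferInstance, inferInstance, inferInstance, isBoundaryGluing_interiorSum φ⟩
  · obtain ⟨CM⟩ := bM.nonempty_openCollar
    haveI : Nonempty bN.carrier := ⟨φ (Classical.arbitrary _)⟩
    obtain ⟨CN⟩ := bN.nonempty_openCollar
    let G : BoundaryGlueData bM bN := ⟨CM, CN, φ⟩
    exact ⟨G.d₂.Glued, inferInstance, inferInstance, inferInstance, inferInstance, inferInstance,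
      inferInstance, G.isBoundaryGluing⟩

end Discharge

/-! ### Discharge of `nonempty_diffeomorph_of_isBoundaryGluing` -/

/-- Local notation: `𝔼 n` is the model Euclidean space `EuclideanSpace ℝ (Fin n)`. -/
local notation "𝔼 " n:arg => EuclideanSpace ℝ (Fin n)
/-- Local notation: `ℍ n` is the closed half space `EuclideanHalfSpace n`. -/
local notation "ℍ " n:arg => EuclideanHalfSpace n

section Instances

variable {n : ℕ} {M N : Type u} [TopologicalSpace M] [ChartedSpace (ℍ (n + 1)) M]
  [TopologicalSpace N] [ChartedSpace (ℍ (n + 1)) N]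
  {bM : BoundaryData (𝓡∂ (n + 1)) M (𝓡 n)} {bN : BoundaryData (𝓡∂ (n + 1)) N (𝓡 n)}
  {P P' : Type u} [TopologicalSpace P] [ChartedSpace (𝔼 (n + 1)) P]
  [TopologicalSpace P'] [ChartedSpace (𝔼 (n + 1)) P']

/-- Gluing data from a witness of the named predicate along a *diffeomorphism* `φ` (the shape
of the hypothesis of the named fact). [folklore] -/
theorem IsBoundaryGluing.nonempty_boundaryGluingData' {φ : bM.carrier ≃ₘ⟮𝓡 n, 𝓡 n⟯ bN.carrier}
    (h : IsBoundaryGluing bM bN φ (𝓡 (n + 1)) P) :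
    Nonempty (BoundaryGluingData bM bN φ.toEquiv P) := by
  obtain ⟨jA, jB, hA, hB, hU, hR⟩ := h
  exact ⟨⟨jA, jB, hA, hB, hU, fun a b => hR a b⟩⟩

/-- **Uniqueness of the gluing `M ∪_φ N` — discharge of the named fact
`Literature.Topology.FourManifolds.nonempty_diffeomorph_of_isBoundaryGluing`** (Hirsch,
*Differential Topology* (1976), Ch. 8, Thm. 2.1; Bröcker–Jänich (1982), (13.9)): for compact
Hausdorff smooth manifolds with boundary `M`, `N` and smooth manifolds `P`, `P'`, if both `P` and
`P'` are the gluing `M ∪_φ N` along the same diffeomorphism `φ : ∂M ≅ ∂N`, then `P ≅ P'`.  The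
hypotheses on `M`, `N`, `P`, `P'` are those of the section of `Gluing.lean` in which the fact is
stated (see the module docstring); proof: `BoundaryGluingData.nonempty_diffeomorph`
(`GluingSmoothing.lean`). [cite: HirschDT1976, Ch. 8 §2, Thm. 2.1] -/
theorem nonempty_diffeomorph_of_isBoundaryGluing_holds [T2Space M] [T2Space N]
    [CompactSpace M] [CompactSpace N] [IsManifold (𝓡∂ (n + 1)) ∞ M] [IsManifold (𝓡∂ (n + 1)) ∞ N]
    [IsManifold (𝓡 (n + 1)) ∞ P] [IsManifold (𝓡 (n + 1)) ∞ P'] :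
    nonempty_diffeomorph_of_isBoundaryGluing (bM := bM) (bN := bN) (P := P) (P' := P') := by
  intro φ hP hP'
  obtain ⟨G⟩ := hP.nonempty_boundaryGluingData'
  obtain ⟨G'⟩ := hP'.nonempty_boundaryGluingData'
  exact G.nonempty_diffeomorph G'

/-- **The named fact for two closed discs `M = N = 𝔻ⁿ⁺¹`** (boundary data
`closedBallBoundaryData n`), for any smooth manifolds `P`, `P'` — no separation hypothesis on
`P`, `P'` is needed (compare `nonempty_diffeomorph_of_isBoundaryGluing_closedBall`,
`BallGluingUniqueness.lean`, which assumes `T2Space P`, `T2Space P'`); this is the shape of the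
hypothesis `hU` of `cerf_twistedSphere_four_of_pi0Diff` (`RadialExtension.lean`).
[cite: HirschDT1976, Ch. 8 §2, Thm. 2.1] -/
theorem nonempty_diffeomorph_of_isBoundaryGluing_closedBall_of_isManifold {n : ℕ}
    [Fact (isSmoothEmbedding_sphereInclusion' n)]
    {P P' : Type} [TopologicalSpace P] [ChartedSpace (𝔼 (n + 1)) P] [IsManifold (𝓡 (n + 1)) ∞ P]
    [TopologicalSpace P'] [ChartedSpace (𝔼 (n + 1)) P'] [IsManifold (𝓡 (n + 1)) ∞ P'] :
    nonempty_diffeomorph_of_isBoundaryGluing (bM := closedBallBoundaryData n)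
      (bN := closedBallBoundaryData n) (P := P) (P' := P') :=
  nonempty_diffeomorph_of_isBoundaryGluing_holds

end Instances

/-- **Uniqueness of gluings, corrected statement of the named fact
`nonempty_diffeomorph_of_isBoundaryGluing` (hypotheses explicit).**  For compact Hausdorff
smooth `(n+1)`-manifolds with boundary `M`, `N` with boundary data `bM`, `bN`, smooth
`(n+1)`-manifolds `P`, `P'`, and a diffeomorphism `φ : ∂M ≅ ∂N`: if both `P` and `P'` are the
gluing `M ∪_φ N` (`IsBoundaryGluing`), then `P ≅ P'`.  The tree's `nonempty_diffeomorph_of_isBoundaryGluing`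
(`Gluing.lean`) intends exactly this (its section assumes compact Hausdorff second countable
pieces) but, as elaborated, carries none of these hypotheses — see the module docstring; this
is the statement as printed for compact pieces: Hirsch, *Differential Topology* (1976), Ch. 8
§2, Thm. 2.1 (no compactness needed there) and Bröcker–Jänich (1982), (13.9) (compact
boundary).  Second countability is not needed and not assumed.
[cite: HirschDT1976, Ch. 8 §2, Thm. 2.1] -/
def nonempty_diffeomorph_of_isBoundaryGluing_compact : Prop :=
  ∀ (n : ℕ) (M N : Type u) [TopologicalSpace M] [T2Space M] [ChartedSpace (ℍ (n + 1)) M]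
    [IsManifold (𝓡∂ (n + 1)) ∞ M] [CompactSpace M] [TopologicalSpace N] [T2Space N]
    [ChartedSpace (ℍ (n + 1)) N] [IsManifold (𝓡∂ (n + 1)) ∞ N] [CompactSpace N]
    (bM : BoundaryData (𝓡∂ (n + 1)) M (𝓡 n)) (bN : BoundaryData (𝓡∂ (n + 1)) N (𝓡 n))
    (P P' : Type u) [TopologicalSpace P] [ChartedSpace (𝔼 (n + 1)) P]
    [IsManifold (𝓡 (n + 1)) ∞ P] [TopologicalSpace P'] [ChartedSpace (𝔼 (n + 1)) P']
    [IsManifold (𝓡 (n + 1)) ∞ P'] (φ : bM.carrier ≃ₘ⟮𝓡 n, 𝓡 n⟯ bN.carrier),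
    IsBoundaryGluing bM bN φ (𝓡 (n + 1)) P → IsBoundaryGluing bM bN φ (𝓡 (n + 1)) P' →
      Nonempty (P ≃ₘ⟮𝓡 (n + 1), 𝓡 (n + 1)⟯ P')

/-- **The corrected named fact holds.** [cite: HirschDT1976, Ch. 8 §2, Thm. 2.1] -/
theorem nonempty_diffeomorph_of_isBoundaryGluing_compact_holds :
    nonempty_diffeomorph_of_isBoundaryGluing_compact.{u} := by
  intro n M N _ _ _ _ _ _ _ _ _ _ bM bN P P' _ _ _ _ _ _ φ hP hP'
  exact nonempty_diffeomorph_of_isBoundaryGluing_holds hP hP'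

end Literature.Topology.FourManifolds
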